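import Mathlib
import Summits.ValiantsHypothesis.ValiantsHypothesis.Theorems.NewtonUnitEquationsTwoProductsPowerSumCriterion
/-! # Stub `stub_recordReduction` — crux `TwoProducts` (stmt-ValiantsHypothesis-5906),
   line `corner-log-linearization`
   Record reduction (stub 7c): with the `2n`-family `f = Fin.append u v` and the rows
   `row_q := (i ↦ coeff_q (∑_{r=1}^{R_e} ((-1)^(r+1)/r) • (f i - 1)^r))`, `R_e := (wt e).toNat + 1`,
   a stable unique lightest support point `e` of the truncated log power sums `Λ_R` has its row
   outside the `ℂ`-span of the rows of the strictly lighter exponents.  Reason: the signed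
   block-sum functional `φ x := ∑_{i<n} x_i - ∑_{i<n} x_{n+i}` sends `row_q` to `coeff_q Λ_{R_e}`,
   which vanishes for every lighter `q` (uniqueness of the lightest point) but not at `q = e`.
   [folklore] -/
set_option linter.dupNamespace false -- single-conjunct summit: `ValiantsHypothesis.ValiantsHypothesis`
namespace Summit.ValiantsHypothesis.ValiantsHypothesis.Theorems.TwoProducts.RecordReduction
open scoped BigOperators
open MvPolynomial

/-- Coefficientwise, `∑_i log u_i - ∑_i log v_i` (truncated, with arbitrary coefficients `κ`)
equals the `κ`-weighted power-sum difference: the `i`- and `r`-sums commute. [folklore] -/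
theorem sum_coeff_sub_sum_coeff {n : ℕ} (u v : Fin n → MvPolynomial (Fin 2) ℂ) (s : Finset ℕ)
    (κ : ℕ → ℂ) (q : Fin 2 →₀ ℕ) :
    ∑ i, coeff q (∑ r ∈ s, κ r • (u i - 1) ^ r) - ∑ i, coeff q (∑ r ∈ s, κ r • (v i - 1) ^ r) =
      coeff q (∑ r ∈ s, κ r • (∑ i, (u i - 1) ^ r - ∑ i, (v i - 1) ^ r)) := by
  simp only [coeff_sum, coeff_smul, coeff_sub, smul_sub, Finset.smul_sum, Finset.sum_sub_distrib]
  congr 1 <;> exact Finset.sum_comm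

/-- The signed block-sum functional `x ↦ ∑_{i<n} x_i - ∑_{i<n} x_{n+i}` on `Fin (n + n) → ℂ` is
`ℂ`-linear. [folklore] -/
theorem exists_blockDiff_linearMap (n : ℕ) :
    ∃ φ : (Fin (n + n) → ℂ) →ₗ[ℂ] ℂ,
      ∀ x, φ x = ∑ i : Fin n, x (Fin.castAdd n i) - ∑ i : Fin n, x (Fin.natAdd n i) :=
  ⟨{ toFun := fun x => ∑ i : Fin n, x (Fin.castAdd n i) - ∑ i : Fin n, x (Fin.natAdd n i)
     map_add' := fun x y => by
       simp only [Pi.add_apply, Finset.sum_add_distrib]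
       ring
     map_smul' := fun c x => by
       simp only [Pi.smul_apply, smul_eq_mul, RingHom.id_apply, Finset.mul_sum, mul_sub] },
    fun _ => rfl⟩

/-- If the signed block-sum functional kills `row q` for every `q ∈ S` but not `row e`, then
`row e` is not in the `ℂ`-span of `row '' S`. [folklore] -/
theorem not_mem_span_image_of_blockDiff {α : Type*} (n : ℕ) (row : α → Fin (n + n) → ℂ)
    (S : Set α) (e : α)
    (hS : ∀ q ∈ S, ∑ i : Fin n, row q (Fin.castAdd n i) - ∑ i : Fin n, row q (Fin.natAdd n i) = 0)
    (he : ∑ i : Fin n, row e (Fin.castAdd n i) - ∑ i : Fin n, row e (Fin.natAdd n i) ≠ 0) :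
    row e ∉ Submodule.span ℂ (row '' S) := by
  obtain ⟨φ, hφ⟩ := exists_blockDiff_linearMap n
  intro hmem
  have hker : row e ∈ LinearMap.ker φ := by
    refine Submodule.span_le.mpr ?_ hmem
    rintro _ ⟨q, hq, rfl⟩
    rw [SetLike.mem_coe, LinearMap.mem_ker, hφ]
    exact hS q hq
  rw [LinearMap.mem_ker, hφ] at hker
  exact he hker

/-- **Record reduction**: if `e` is the unique `w`-lightest support point of every truncated log
power sum `Λ_R`, `R > wt e`, then at the order `R_e = (wt e).toNat + 1` the row
`i ↦ coeff_e (log_{R_e} (f i))`, `f = Fin.append u v`, is not in the `ℂ`-span of the rows of the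
strictly `w`-lighter exponents. [folklore] -/
theorem stub_recordReduction : ∀ (n : ℕ) (u v : Fin n → MvPolynomial (Fin 2) ℂ),
    (∀ i, MvPolynomial.coeff 0 (u i) = 1) → (∀ i, MvPolynomial.coeff 0 (v i) = 1) →
    ∀ (w : Fin 2 → ℤ), 0 < w 0 → 0 < w 1 → ∀ (e : Fin 2 →₀ ℕ),
    (∀ R : ℕ, w 0 * (e 0 : ℤ) + w 1 * (e 1 : ℤ) < (R : ℤ) →
      (e ∈ (∑ r ∈ Finset.Icc 1 R, ((-1 : ℂ) ^ (r + 1) / (r : ℂ)) •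
          (∑ i, (u i - 1) ^ r - ∑ i, (v i - 1) ^ r)).support ∧
        ∀ e' ∈ (∑ r ∈ Finset.Icc 1 R, ((-1 : ℂ) ^ (r + 1) / (r : ℂ)) •
          (∑ i, (u i - 1) ^ r - ∑ i, (v i - 1) ^ r)).support, e' ≠ e →
          w 0 * (e 0 : ℤ) + w 1 * (e 1 : ℤ) < w 0 * (e' 0 : ℤ) + w 1 * (e' 1 : ℤ))) →
    (fun i : Fin (n + n) => MvPolynomial.coeff e
          (∑ r ∈ Finset.Icc 1 ((w 0 * (e 0 : ℤ) + w 1 * (e 1 : ℤ)).toNat + 1),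
            ((-1 : ℂ) ^ (r + 1) / (r : ℂ)) • (Fin.append u v i - 1) ^ r)) ∉
        Submodule.span ℂ ((fun q : Fin 2 →₀ ℕ => fun i : Fin (n + n) => MvPolynomial.coeff q
          (∑ r ∈ Finset.Icc 1 ((w 0 * (e 0 : ℤ) + w 1 * (e 1 : ℤ)).toNat + 1),
            ((-1 : ℂ) ^ (r + 1) / (r : ℂ)) • (Fin.append u v i - 1) ^ r)) ''
          {q : Fin 2 →₀ ℕ | w 0 * (q 0 : ℤ) + w 1 * (q 1 : ℤ) < w 0 * (e 0 : ℤ) + w 1 * (e 1 : ℤ)}) := by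
  intro n u v _ _ w _ _ e hstab
  obtain ⟨he, hmin⟩ := hstab ((w 0 * (e 0 : ℤ) + w 1 * (e 1 : ℤ)).toNat + 1)
    (by push_cast; linarith [Int.self_le_toNat (w 0 * (e 0 : ℤ) + w 1 * (e 1 : ℤ))])
  refine not_mem_span_image_of_blockDiff n
    (fun (q : Fin 2 →₀ ℕ) (i : Fin (n + n)) => MvPolynomial.coeff q
      (∑ r ∈ Finset.Icc 1 ((w 0 * (e 0 : ℤ) + w 1 * (e 1 : ℤ)).toNat + 1),
        ((-1 : ℂ) ^ (r + 1) / (r : ℂ)) • (Fin.append u v i - 1) ^ r)) _ e (fun q hq => ?_) ?_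
  · rw [Set.mem_setOf_eq] at hq
    simp only [Fin.append_left, Fin.append_right]
    rw [sum_coeff_sub_sum_coeff]
    by_contra hne
    exact lt_asymm hq (hmin q (mem_support_iff.mpr hne) (by rintro rfl; exact lt_irrefl _ hq))
  · simp only [Fin.append_left, Fin.append_right]
    rw [sum_coeff_sub_sum_coeff]
    exact mem_support_iff.mp he

end Summit.ValiantsHypothesis.ValiantsHypothesis.Theorems.TwoProducts.RecordReduction
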